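import Summits.QuantumFields.YangMills.Theorems.FluctuationComparisonRegPrIntLS2BetaCovariantOscillationRegUpProfiled
import HarnessLib

/-!
# S2β · c₁ column (C-M↓) — «THE SIZE PROFILE AT THE CHART TOWER»: for a tower of 𝔰𝔲(N)-valued data `Xd l` on `F.P K` with one-step second-order remainders `r` (profile `Cr·L^{2i}·η²`)
# and fine size `‖↑(Xd 0 b)‖ ≤ c·η`: `‖↑(Xd l b)‖ ≤ Λ̄·(c + Cr∕(L−1))·L^l·η` for every `l ≤ k` (`L^l·η ≤ 1`) — px20 g25's (C-M↓) target over px12's instances: the k-step sup row ✓(D2),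
# the instantiated second-order remainder ✓p840756, `Λ_l ≤ Λ̄` ✓p840940, geometric sums

Cell `ym3-torus` (YM ladder rung R3 = continuum `SU(2)` Yang–Mills on the three-torus at fixed lattice data — a RUNG: NOT d = 4, NOT infinite volume, NOT a mass gap,
NOT Clay).  Width seat «width 12» `ym3-torus-px12` (gen 27); crux `stmt-QuantumFields-20520`, LINE g18-1 S2β, c₁ column (px20 g25 05:01:56Z (C-M↓) intent; px12 «MINE» 05:02Z; consumer w4 g29 (g3)).
`--kind proof --supports stmt-QuantumFields-20520 --as helper`, count-neutral, DEFINITION-FREE (0 `def`, 0 `instance`, 0 `notation`, 0 `sorry`, default heartbeats).  `SU(N)`, towers `F.P K`, `k ≤ m + K`.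

WHAT IS PROVED (sorry-free).  `remainderSum_le` (`Σ_{i<l} Λ̄·L^{l−1−i}·r(i+1) ≤ Λ̄·(Cr∕(L−1))·L^l·η` under `r(i+1) ≤ Cr·L^{2i}·η²`, `L^l·η ≤ 1`), ★★★**`sizeProfile_chartTower`** (module title),
★★`sizeProfile_letters` — the consumer's three shapes at `η := (L⁻¹)^{K−J}`: `hMb : ‖↑(Xd l b)‖ ≤ Mb l`, `hMbsq : Mb l ^ 2 ≤ m ^ 2 * (L^{2l} ∕ L^{2(K−J)})` hmm stated as an identity-bound, `hMbm : Mb l ≤ m`,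
with `Mb l := Λ̄·(c + Cr∕(L−1))·L^l·(L⁻¹)^{K−J}`, `m := Λ̄·(c + Cr∕(L−1))`.

HONEST SCOPE.  Bookkeeping over landed letters; nothing of Bałaban's renormalisation-group analysis proved; `r`∕`Cr` ((REG)@rep second order), `c` (`hζc`, Thm 2 (1.36) at the representative), the guards and their
profile `Cα` are HYPOTHESES; (g3) (w4), `hBG` lane, GAP♯∘ (`stub_uniformFibreGapOrbit`, registry 3732b7df UNTOUCHED, 0∕5), the five registered stubs, S2β, crux 20520, 19936, 19200, `YM3TorusSU2` — NOT
proved; rung R3 — NOT d = 4, NOT infinite volume, NOT a mass gap, NOT Clay; the Yang–Mills mass gap is NOT proved.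
-/

set_option autoImplicit false

noncomputable section

open scoped Matrix.Norms.L2Operator Topology
open Filter Set Function

namespace Summit.QuantumFields.YangMills.Theorems.FluctuationComparisonRegPrIntLS2BetaRelativeSizeProfileChartTower

open Literature.MathematicalPhysics.QuantumFieldTheory.Balaban1983to89
open Literature.MathematicalPhysics.QuantumFieldTheory.Balaban1983to89.HaarExponentialChart
open Literature.MathematicalPhysics.QuantumFieldTheory.Balaban1983to89.HaarExponentialChart.IsChartRep
open Literature.MathematicalPhysics.QuantumFieldTheory.Balaban1983to89.BlockAveraging (Small Idx avgFun loopHol blockAvg blockAvg_avg)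
open Literature.MathematicalPhysics.QuantumFieldTheory.Balaban1983to89.ExpMeanLog (expMeanLogSU deltaSU)
open Literature.MathematicalPhysics.QuantumFieldTheory.Balaban1983to89.Node00
open Literature.MathematicalPhysics.QuantumFieldTheory.Balaban1983to89.T3ContinuumYM3Torus
open Summit.QuantumFields.YangMills.BalabanUVNodes.N09ChartReadAveragingSmooth
open Summit.QuantumFields.YangMills.Theorems.FluctuationComparisonRegPrIntLS2BetaChartReadDerivKStepSup (norm_fderiv_chartRead_iter_apply_le_exp)
open Summit.QuantumFields.YangMills.Theorems.FluctuationComparisonRegPrIntLS2BetaSecondOrderTowerSupClosed (norm_sub_fderiv_chartRead_iter_le)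
open Summit.QuantumFields.YangMills.Theorems.FluctuationComparisonRegPrIntLS2BetaCovariantOscillationRegUpProfiled (rowConst_le_bar)
open Summit.QuantumFields.YangMills.Theorems.FluctuationComparisonRegPrIntLS2BetaAveragedBondWord (geom_mixed_sum)

variable {N : ℕ} [NeZero N] (F : T3Family)

/-- ★ The summed remainders under the profile: `Σ_{i<l} Λ̄·L^{l−1−i}·r(i+1) ≤ Λ̄·(Cr∕(L−1))·L^l·η` for `1 < L`, `0 ≤ Λ̄, Cr, η`, `L^l·η ≤ 1`, `r(i+1) ≤ Cr·L^{2i}·η²`. [folklore] -/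
theorem remainderSum_le {L Λb Cr η : ℝ} (hL : 1 < L) (hΛb : 0 ≤ Λb) (hCr : 0 ≤ Cr) (hη : 0 ≤ η) (l : ℕ) (hθ : L ^ l * η ≤ 1) (r : ℕ → ℝ)
    (hrp : ∀ i, i < l → r (i + 1) ≤ Cr * L ^ (2 * i) * η ^ 2) :
    ∑ i ∈ Finset.range l, Λb * L ^ (l - 1 - i) * r (i + 1) ≤ Λb * (Cr / (L - 1)) * L ^ l * η := by
  have hL0 : 0 ≤ L := by linarith
  have h1 : ∑ i ∈ Finset.range l, Λb * L ^ (l - 1 - i) * r (i + 1) ≤ ∑ i ∈ Finset.range l, (Λb * Cr * η ^ 2) * (L ^ (l - 1 - i) * L ^ (2 * i)) := by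
    refine Finset.sum_le_sum fun i hi => ?_
    rw [Finset.mem_range] at hi
    have hp : 0 ≤ Λb * L ^ (l - 1 - i) := by positivity
    calc Λb * L ^ (l - 1 - i) * r (i + 1) ≤ Λb * L ^ (l - 1 - i) * (Cr * L ^ (2 * i) * η ^ 2) := mul_le_mul_of_nonneg_left (hrp i hi) hp
      _ = (Λb * Cr * η ^ 2) * (L ^ (l - 1 - i) * L ^ (2 * i)) := by ring
  refine h1.trans ?_
  rw [← Finset.mul_sum, geom_mixed_sum L hL l]
  have hLL : 0 < L ^ 2 - L := by nlinarith
  have hL1 : 0 < L - 1 := by linarith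
  have hLl : 0 ≤ L ^ l := pow_nonneg hL0 l
  -- `(L^{2l} − L^l)∕(L²−L) ≤ L^{2l}∕(L²−L) = L^l·L^l∕(L(L−1))` and `L^l·η ≤ 1`, `1∕L ≤ 1`
  have h2 : (L ^ (2 * l) - L ^ l) / (L ^ 2 - L) ≤ L ^ l * L ^ l / (L * (L - 1)) := by
    rw [show L ^ 2 - L = L * (L - 1) by ring, div_le_div_iff_of_pos_right (by positivity), two_mul, pow_add]
    linarith
  have h3 : Λb * Cr * η ^ 2 * (L ^ l * L ^ l / (L * (L - 1))) = Λb * (Cr / (L - 1)) * L ^ l * η * ((L ^ l * η) / L) := by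
    field_simp
  calc Λb * Cr * η ^ 2 * ((L ^ (2 * l) - L ^ l) / (L ^ 2 - L)) ≤ Λb * Cr * η ^ 2 * (L ^ l * L ^ l / (L * (L - 1))) :=
        mul_le_mul_of_nonneg_left h2 (by positivity)
    _ = Λb * (Cr / (L - 1)) * L ^ l * η * ((L ^ l * η) / L) := h3
    _ ≤ Λb * (Cr / (L - 1)) * L ^ l * η * 1 := by
        refine mul_le_mul_of_nonneg_left ?_ (by positivity)
        rw [div_le_one (by linarith)]
        exact hθ.trans hL.le
    _ = Λb * (Cr / (L - 1)) * L ^ l * η := mul_one _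

/-- ★★★ **THE SIZE PROFILE AT THE CHART TOWER**: for `l ≤ k ≤ m + K`, under the loop guards `α` below `k` (`0 ≤ α_j ≤ 1∕24`, `α_j < δ_N`) with profile `α_j ≤ Cα·L^{2j}·η²`,
`L^l·η ≤ 1`, the fine size `‖↑(Xd 0 b)‖ ≤ c·η` and one-step second-order remainders `‖↑(Xd (i+1) c′) − ↑(Dψ_{Ū^iU₀}(Xd i) c′)‖ ≤ r(i+1) ≤ Cr·L^{2i}·η²`:
**`‖↑(Xd l b)‖ ≤ Λ̄·(c + Cr∕(L−1))·L^l·η`** (✓(D2) + ✓p840756 + ✓`rowConst_le_bar`). [cite: Balaban1985Averaging, Prop. 4 (128)-(131) pp.37-38; Balaban1985RegularSpaces, (1.36) p.82] -/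
theorem sizeProfile_chartTower {K k : ℕ} (hk : k ≤ F.m + K) (U₀ : GaugeField (F.P K) 0 (SU N)) (Xd : (i : ℕ) → (PBond (F.P K) i → (specialUnitaryLogChart (Fin N)).lie))
    {α r : ℕ → ℝ} {c Cr Cα η : ℝ} (hα0 : ∀ l, 0 ≤ α l) (hα24 : ∀ l, α l ≤ 1 / 24) (hαδ : ∀ l, α l < deltaSU (Fin N))
    (hαU : (∀ l, l < k → ∀ (c : PBond (F.P K) (l + 1)) (idx : Idx (F.P K)), dist1 (loopHol (Averaging.iter (fun i => blockAvg (P := F.P K) (j := i) (expMeanLogSU (n := Fin N))) l U₀) c idx) ≤ α l))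
    (hCα : 0 ≤ Cα) (hη : 0 ≤ η) (hαp : ∀ j, j < k → α j ≤ Cα * ((F.P K).L : ℝ) ^ (2 * j) * η ^ 2) (hθ : ∀ l, l ≤ k → ((F.P K).L : ℝ) ^ l * η ≤ 1)
    (hc : 0 ≤ c) (hζc : ∀ b : PBond (F.P K) 0, ‖(((Xd 0) b : (specialUnitaryLogChart (Fin N)).lie) : Matrix (Fin N) (Fin N) ℂ)‖ ≤ c * η)
    (hr0 : ∀ i, 0 ≤ r i) (hCr : 0 ≤ Cr)
    (hr : ∀ i, i < k → ∀ c' : PBond (F.P K) (i + 1),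
      ‖((Xd (i + 1) c' : (specialUnitaryLogChart (Fin N)).lie) : Matrix (Fin N) (Fin N) ℂ) - (((fderiv ℝ (fun (B : PBond (F.P K) i → (specialUnitaryLogChart (Fin N)).lie) (c' : PBond (F.P K) (i + 1)) => (isChartRep_specialUnitaryGroup (n := Fin N)).logChart (avgFun (expMeanLogSU (n := Fin N)) (fun c => (isChartRep_specialUnitaryGroup (n := Fin N)).expChart (B c) * (Averaging.iter (fun i => blockAvg (P := F.P K) (j := i) (expMeanLogSU (n := Fin N))) i U₀) c) c' * (avgFun (expMeanLogSU (n := Fin N)) ((Averaging.iter (fun i => blockAvg (P := F.P K) (j := i) (expMeanLogSU (n := Fin N))) i U₀)) c')⁻¹)) 0) (Xd i) c' : (specialUnitaryLogChart (Fin N)).lie) : Matrix (Fin N) (Fin N) ℂ)‖ ≤ r (i + 1))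
    (hrp : ∀ i, i < k → r (i + 1) ≤ Cr * ((F.P K).L : ℝ) ^ (2 * i) * η ^ 2) :
    ∀ l, l ≤ k → ∀ b : PBond (F.P K) l, ‖((Xd l b : (specialUnitaryLogChart (Fin N)).lie) : Matrix (Fin N) (Fin N) ℂ)‖ ≤ ((1 + 4 * (((F.P K).d + 2 : ℕ) : ℝ)) * Real.exp ((((F.P K).d + 2 : ℕ) : ℝ) * (422 + 1616 * (((F.P K).d + 2 : ℕ) : ℝ)) * (Cα / (((F.P K).L : ℝ) ^ 2 - 1)))) * (c + Cr / (((F.P K).L : ℝ) - 1)) * ((F.P K).L : ℝ) ^ l * η := by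
  intro l hl b
  have hL : (1 : ℝ) < ((F.P K).L : ℝ) := by
    have h := (F.hL).2
    have e : (F.P K).L = F.L := rfl
    rw [e]; exact_mod_cast h
  have hlK : l ≤ F.m + K := by omega
  have hαUl : (∀ j, j < l → ∀ (c : PBond (F.P K) (j + 1)) (idx : Idx (F.P K)), dist1 (loopHol (Averaging.iter (fun i => blockAvg (P := F.P K) (j := i) (expMeanLogSU (n := Fin N))) j U₀) c idx) ≤ α j) := fun j hj cc idx => hαU j (by omega) cc idx
  -- the row constant at level `l` and the level-free one (`q := η²`)
  have hθ1 : ((F.P K).L : ℝ) ^ (2 * l) * η ^ 2 ≤ 1 := by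
    have e : ((F.P K).L : ℝ) ^ (2 * l) * η ^ 2 = (((F.P K).L : ℝ) ^ l * η) ^ 2 := by ring
    rw [e]
    have h0 : 0 ≤ ((F.P K).L : ℝ) ^ l * η := by positivity
    nlinarith [hθ l hl]
  have hΛ := rowConst_le_bar F (K := K) (k := l) (q := η ^ 2) (Cα := Cα) (by positivity) hCα α (fun j hj => hαp j (by omega)) hθ1
  have hΛl0 : (0 : ℝ) ≤ ((1 + 4 * (((F.P K).d + 2 : ℕ) : ℝ)) * Real.exp ((((F.P K).d + 2 : ℕ) : ℝ) * (422 + 1616 * (((F.P K).d + 2 : ℕ) : ℝ)) * ∑ j ∈ Finset.range l, α j)) := by positivity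
  have hΛb0 : (0 : ℝ) ≤ ((1 + 4 * (((F.P K).d + 2 : ℕ) : ℝ)) * Real.exp ((((F.P K).d + 2 : ℕ) : ℝ) * (422 + 1616 * (((F.P K).d + 2 : ℕ) : ℝ)) * (Cα / (((F.P K).L : ℝ) ^ 2 - 1)))) := by positivity
  -- (1) the linear part `‖↑(DΨ_l (Xd 0) b)‖ ≤ Λ_l·L^l·‖Xd 0‖ ≤ Λ̄·L^l·(c·η)`
  have hX0 : ‖Xd 0‖ ≤ c * η := (pi_norm_le_iff_of_nonneg (by positivity)).2 fun bb => by rw [← Submodule.norm_coe]; exact hζc bb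
  have hlin : ‖(((fderiv ℝ (fun (A : PBond (F.P K) 0 → (specialUnitaryLogChart (Fin N)).lie) (c : PBond (F.P K) l) => (isChartRep_specialUnitaryGroup (n := Fin N)).logChart (Averaging.iter (fun i => blockAvg (P := F.P K) (j := i) (expMeanLogSU (n := Fin N))) l (fun b => (isChartRep_specialUnitaryGroup (n := Fin N)).expChart (A b) * U₀ b) c * (Averaging.iter (fun i => blockAvg (P := F.P K) (j := i) (expMeanLogSU (n := Fin N))) l U₀ c)⁻¹)) 0) (Xd 0) b : (specialUnitaryLogChart (Fin N)).lie) : Matrix (Fin N) (Fin N) ℂ)‖ ≤ ((1 + 4 * (((F.P K).d + 2 : ℕ) : ℝ)) * Real.exp ((((F.P K).d + 2 : ℕ) : ℝ) * (422 + 1616 * (((F.P K).d + 2 : ℕ) : ℝ)) * (Cα / (((F.P K).L : ℝ) ^ 2 - 1)))) * ((F.P K).L : ℝ) ^ l * (c * η) := by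
    refine (norm_fderiv_chartRead_iter_apply_le_exp (P := F.P K) (N := N) U₀ (Xd 0) hα0 hα24 hαδ l hαUl b).trans ?_
    have hLl : (0 : ℝ) ≤ ((F.P K).L : ℝ) ^ l := by positivity
    exact mul_le_mul (mul_le_mul_of_nonneg_right hΛ hLl) hX0 (norm_nonneg _) (by positivity)
  -- (2) the second-order part (✓p840756) under the profile
  have hrem := norm_sub_fderiv_chartRead_iter_le F hlK U₀ hα0 hα24 hαδ hr0 hαUl Xd (fun i hi cc => hr i (by omega) cc) b
  have hrem' : ‖((Xd l b : (specialUnitaryLogChart (Fin N)).lie) : Matrix (Fin N) (Fin N) ℂ) - (((fderiv ℝ (fun (A : PBond (F.P K) 0 → (specialUnitaryLogChart (Fin N)).lie) (c : PBond (F.P K) l) => (isChartRep_specialUnitaryGroup (n := Fin N)).logChart (Averaging.iter (fun i => blockAvg (P := F.P K) (j := i) (expMeanLogSU (n := Fin N))) l (fun b => (isChartRep_specialUnitaryGroup (n := Fin N)).expChart (A b) * U₀ b) c * (Averaging.iter (fun i => blockAvg (P := F.P K) (j := i) (expMeanLogSU (n := Fin N))) l U₀ c)⁻¹)) 0) (Xd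 0) b : (specialUnitaryLogChart (Fin N)).lie) : Matrix (Fin N) (Fin N) ℂ)‖ ≤ ((1 + 4 * (((F.P K).d + 2 : ℕ) : ℝ)) * Real.exp ((((F.P K).d + 2 : ℕ) : ℝ) * (422 + 1616 * (((F.P K).d + 2 : ℕ) : ℝ)) * (Cα / (((F.P K).L : ℝ) ^ 2 - 1)))) * (Cr / (((F.P K).L : ℝ) - 1)) * ((F.P K).L : ℝ) ^ l * η := by
    refine hrem.trans ?_
    have hstep : ∑ i ∈ Finset.range l, ((1 + 4 * (((F.P K).d + 2 : ℕ) : ℝ)) * Real.exp ((((F.P K).d + 2 : ℕ) : ℝ) * (422 + 1616 * (((F.P K).d + 2 : ℕ) : ℝ)) * ∑ j ∈ Finset.range l, α j)) * ((F.P K).L : ℝ) ^ (l - 1 - i) * r (i + 1) ≤ ∑ i ∈ Finset.range l, ((1 + 4 * (((F.P K).d + 2 : ℕ) : ℝ)) * Real.exp ((((F.P K).d + 2 : ℕ) : ℝ) * (422 + 1616 * (((F.P K).d + 2 : ℕ) : ℝ)) * (Cα / (((F.P K).L : ℝ) ^ 2 - 1)))) * ((F.P K).L : ℝ) ^ (l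 - 1 - i) * r (i + 1) :=
      Finset.sum_le_sum fun i _ => mul_le_mul_of_nonneg_right (mul_le_mul_of_nonneg_right hΛ (by positivity)) (hr0 _)
    exact hstep.trans (remainderSum_le hL hΛb0 hCr hη l (hθ l hl) r (fun i hi => hrp i (by omega)))
  -- assemble: `‖x‖ ≤ ‖y‖ + ‖x − y‖`
  have htri : ‖((Xd l b : (specialUnitaryLogChart (Fin N)).lie) : Matrix (Fin N) (Fin N) ℂ)‖ ≤ ‖(((fderiv ℝ (fun (A : PBond (F.P K) 0 → (specialUnitaryLogChart (Fin N)).lie) (c : PBond (F.P K) l) => (isChartRep_specialUnitaryGroup (n := Fin N)).logChart (Averaging.iter (fun i => blockAvg (P := F.P K) (j := i) (expMeanLogSU (n := Fin N))) l (fun b => (isChartRep_specialUnitaryGroup (n := Fin N)).expChart (A b) * U₀ b) c * (Averaging.iter (fun i => blockAvg (P := F.P K) (j := i) (expMeanLogSU (n := Fin N))) l U₀ c)⁻¹)) 0) (Xd 0) b : (specialUnitaryLogChart (Fin N)).lie) : Matrix (Fin N) (Fin N) ℂ)‖ +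
      ‖((Xd l b : (specialUnitaryLogChart (Fin N)).lie) : Matrix (Fin N) (Fin N) ℂ) - (((fderiv ℝ (fun (A : PBond (F.P K) 0 → (specialUnitaryLogChart (Fin N)).lie) (c : PBond (F.P K) l) => (isChartRep_specialUnitaryGroup (n := Fin N)).logChart (Averaging.iter (fun i => blockAvg (P := F.P K) (j := i) (expMeanLogSU (n := Fin N))) l (fun b => (isChartRep_specialUnitaryGroup (n := Fin N)).expChart (A b) * U₀ b) c * (Averaging.iter (fun i => blockAvg (P := F.P K) (j := i) (expMeanLogSU (n := Fin N))) l U₀ c)⁻¹)) 0) (Xd 0) b : (specialUnitaryLogChart (Fin N)).lie) : Matrix (Fin N) (Fin N) ℂ)‖ := norm_le_norm_add_norm_sub' _ _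
  have e : ((1 + 4 * (((F.P K).d + 2 : ℕ) : ℝ)) * Real.exp ((((F.P K).d + 2 : ℕ) : ℝ) * (422 + 1616 * (((F.P K).d + 2 : ℕ) : ℝ)) * (Cα / (((F.P K).L : ℝ) ^ 2 - 1)))) * (c + Cr / (((F.P K).L : ℝ) - 1)) * ((F.P K).L : ℝ) ^ l * η = ((1 + 4 * (((F.P K).d + 2 : ℕ) : ℝ)) * Real.exp ((((F.P K).d + 2 : ℕ) : ℝ) * (422 + 1616 * (((F.P K).d + 2 : ℕ) : ℝ)) * (Cα / (((F.P K).L : ℝ) ^ 2 - 1)))) * ((F.P K).L : ℝ) ^ l * (c * η) + ((1 + 4 * (((F.P K).d + 2 : ℕ) : ℝ)) * Real.exp ((((F.P K).d + 2 : ℕ) : ℝ) * (422 + 1616 * (((F.P K).d + 2 : ℕ) : ℝ)) * (Cα / (((F.P K).L : ℝ) ^ 2 - 1)))) * (Cr / (((F.P K).L : ℝ) - 1)) * ((F.P K).L : ℝ) ^ l * η := by ring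
  rw [e]
  exact htri.trans (add_le_add hlin hrem')

/-- ★★ **THE CONSUMER's THREE SHAPES** at `η := (L⁻¹)^{K−J}` (`k := K − J ≤ m + K`): with `Mb l := Λ̄·(c + Cr∕(L−1))·L^l·(L⁻¹)^{K−J}` and `m := Λ̄·(c + Cr∕(L−1))`:
`∀ l ≤ K−J, ∀ b, ‖↑(Xd l b)‖ ≤ Mb l`, `Mb l ^ 2 = m ^ 2 · (L^{2l} ∕ L^{2(K−J)})`, `Mb l ≤ m` (for `l ≤ K − J`). [cite: Balaban1985Averaging, Prop. 4 (128)-(131) pp.37-38] -/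
theorem sizeProfile_letters {K J : ℕ} (hk : K - J ≤ F.m + K) (U₀ : GaugeField (F.P K) 0 (SU N)) (Xd : (i : ℕ) → (PBond (F.P K) i → (specialUnitaryLogChart (Fin N)).lie))
    {α r : ℕ → ℝ} {c Cr Cα : ℝ} (hα0 : ∀ l, 0 ≤ α l) (hα24 : ∀ l, α l ≤ 1 / 24) (hαδ : ∀ l, α l < deltaSU (Fin N))
    (hαU : (∀ l, l < (K - J) → ∀ (c : PBond (F.P K) (l + 1)) (idx : Idx (F.P K)), dist1 (loopHol (Averaging.iter (fun i => blockAvg (P := F.P K) (j := i) (expMeanLogSU (n := Fin N))) l U₀) c idx) ≤ α l))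
    (hCα : 0 ≤ Cα) (hαp : ∀ j, j < K - J → α j ≤ Cα * ((F.P K).L : ℝ) ^ (2 * j) * ((((F.P K).L : ℝ))⁻¹ ^ (K - J)) ^ 2)
    (hc : 0 ≤ c) (hζc : ∀ b : PBond (F.P K) 0, ‖(((Xd 0) b : (specialUnitaryLogChart (Fin N)).lie) : Matrix (Fin N) (Fin N) ℂ)‖ ≤ c * ((((F.P K).L : ℝ))⁻¹ ^ (K - J)))
    (hr0 : ∀ i, 0 ≤ r i) (hCr : 0 ≤ Cr)
    (hr : ∀ i, i < K - J → ∀ c' : PBond (F.P K) (i + 1),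
      ‖((Xd (i + 1) c' : (specialUnitaryLogChart (Fin N)).lie) : Matrix (Fin N) (Fin N) ℂ) - (((fderiv ℝ (fun (B : PBond (F.P K) i → (specialUnitaryLogChart (Fin N)).lie) (c' : PBond (F.P K) (i + 1)) => (isChartRep_specialUnitaryGroup (n := Fin N)).logChart (avgFun (expMeanLogSU (n := Fin N)) (fun c => (isChartRep_specialUnitaryGroup (n := Fin N)).expChart (B c) * (Averaging.iter (fun i => blockAvg (P := F.P K) (j := i) (expMeanLogSU (n := Fin N))) i U₀) c) c' * (avgFun (expMeanLogSU (n := Fin N)) ((Averaging.iter (fun i => blockAvg (P := F.P K) (j := i) (expMeanLogSU (n := Fin N))) i U₀)) c')⁻¹)) 0) (Xd i) c' : (specialUnitaryLogChart (Fin N)).lie) : Matrix (Fin N) (Fin N) ℂ)‖ ≤ r (i + 1))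
    (hrp : ∀ i, i < K - J → r (i + 1) ≤ Cr * ((F.P K).L : ℝ) ^ (2 * i) * ((((F.P K).L : ℝ))⁻¹ ^ (K - J)) ^ 2) :
    (∀ l, l ≤ K - J → ∀ b : PBond (F.P K) l, ‖((Xd l b : (specialUnitaryLogChart (Fin N)).lie) : Matrix (Fin N) (Fin N) ℂ)‖ ≤ ((1 + 4 * (((F.P K).d + 2 : ℕ) : ℝ)) * Real.exp ((((F.P K).d + 2 : ℕ) : ℝ) * (422 + 1616 * (((F.P K).d + 2 : ℕ) : ℝ)) * (Cα / (((F.P K).L : ℝ) ^ 2 - 1)))) * (c + Cr / (((F.P K).L : ℝ) - 1)) * ((F.P K).L : ℝ) ^ l * ((((F.P K).L : ℝ))⁻¹ ^ (K - J))) ∧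
    (∀ l, l ≤ K - J → (((1 + 4 * (((F.P K).d + 2 : ℕ) : ℝ)) * Real.exp ((((F.P K).d + 2 : ℕ) : ℝ) * (422 + 1616 * (((F.P K).d + 2 : ℕ) : ℝ)) * (Cα / (((F.P K).L : ℝ) ^ 2 - 1)))) * (c + Cr / (((F.P K).L : ℝ) - 1)) * ((F.P K).L : ℝ) ^ l * ((((F.P K).L : ℝ))⁻¹ ^ (K - J))) ^ 2 =
      (((1 + 4 * (((F.P K).d + 2 : ℕ) : ℝ)) * Real.exp ((((F.P K).d + 2 : ℕ) : ℝ) * (422 + 1616 * (((F.P K).d + 2 : ℕ) : ℝ)) * (Cα / (((F.P K).L : ℝ) ^ 2 - 1)))) * (c + Cr / (((F.P K).L : ℝ) - 1))) ^ 2 * (((F.P K).L : ℝ) ^ (2 * l) / ((F.P K).L : ℝ) ^ (2 * (K - J)))) ∧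
    (∀ l, l ≤ K - J → ((1 + 4 * (((F.P K).d + 2 : ℕ) : ℝ)) * Real.exp ((((F.P K).d + 2 : ℕ) : ℝ) * (422 + 1616 * (((F.P K).d + 2 : ℕ) : ℝ)) * (Cα / (((F.P K).L : ℝ) ^ 2 - 1)))) * (c + Cr / (((F.P K).L : ℝ) - 1)) * ((F.P K).L : ℝ) ^ l * ((((F.P K).L : ℝ))⁻¹ ^ (K - J)) ≤ ((1 + 4 * (((F.P K).d + 2 : ℕ) : ℝ)) * Real.exp ((((F.P K).d + 2 : ℕ) : ℝ) * (422 + 1616 * (((F.P K).d + 2 : ℕ) : ℝ)) * (Cα / (((F.P K).L : ℝ) ^ 2 - 1)))) * (c + Cr / (((F.P K).L : ℝ) - 1))) := by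
  have hL : (1 : ℝ) < ((F.P K).L : ℝ) := by
    have h := (F.hL).2
    have e : (F.P K).L = F.L := rfl
    rw [e]; exact_mod_cast h
  have hL0 : (0 : ℝ) < ((F.P K).L : ℝ) := by linarith
  have hη : (0 : ℝ) ≤ ((((F.P K).L : ℝ))⁻¹ ^ (K - J)) := by positivity
  -- `L^l·(L⁻¹)^{K−J} ≤ 1` for `l ≤ K − J`
  have hθ : ∀ l, l ≤ K - J → ((F.P K).L : ℝ) ^ l * ((((F.P K).L : ℝ))⁻¹ ^ (K - J)) ≤ 1 := by
    intro l hl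
    rw [inv_pow, ← div_eq_mul_inv, div_le_one (by positivity)]
    exact pow_le_pow_right₀ hL.le hl
  refine ⟨sizeProfile_chartTower F hk U₀ Xd hα0 hα24 hαδ hαU hCα hη hαp hθ hc hζc hr0 hCr hr hrp, fun l hl => ?_, fun l hl => ?_⟩
  · have hLp : ((F.P K).L : ℝ) ^ (2 * (K - J)) ≠ 0 := by positivity
    rw [inv_pow, pow_mul, pow_mul]
    field_simp
    ring
  · have hm0 : (0 : ℝ) ≤ ((1 + 4 * (((F.P K).d + 2 : ℕ) : ℝ)) * Real.exp ((((F.P K).d + 2 : ℕ) : ℝ) * (422 + 1616 * (((F.P K).d + 2 : ℕ) : ℝ)) * (Cα / (((F.P K).L : ℝ) ^ 2 - 1)))) * (c + Cr / (((F.P K).L : ℝ) - 1)) := by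
      have : (0 : ℝ) < ((F.P K).L : ℝ) - 1 := by linarith
      positivity
    have := hθ l hl
    calc ((1 + 4 * (((F.P K).d + 2 : ℕ) : ℝ)) * Real.exp ((((F.P K).d + 2 : ℕ) : ℝ) * (422 + 1616 * (((F.P K).d + 2 : ℕ) : ℝ)) * (Cα / (((F.P K).L : ℝ) ^ 2 - 1)))) * (c + Cr / (((F.P K).L : ℝ) - 1)) * ((F.P K).L : ℝ) ^ l * ((((F.P K).L : ℝ))⁻¹ ^ (K - J)) = ((1 + 4 * (((F.P K).d + 2 : ℕ) : ℝ)) * Real.exp ((((F.P K).d + 2 : ℕ) : ℝ) * (422 + 1616 * (((F.P K).d + 2 : ℕ) : ℝ)) * (Cα / (((F.P K).L : ℝ) ^ 2 - 1)))) * (c + Cr / (((F.P K).L : ℝ) - 1)) * (((F.P K).L : ℝ) ^ l * ((((F.P K).L : ℝ))⁻¹ ^ (K - J))) := by ring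
      _ ≤ ((1 + 4 * (((F.P K).d + 2 : ℕ) : ℝ)) * Real.exp ((((F.P K).d + 2 : ℕ) : ℝ) * (422 + 1616 * (((F.P K).d + 2 : ℕ) : ℝ)) * (Cα / (((F.P K).L : ℝ) ^ 2 - 1)))) * (c + Cr / (((F.P K).L : ℝ) - 1)) * 1 := mul_le_mul_of_nonneg_left this hm0
      _ = _ := mul_one _

end Summit.QuantumFields.YangMills.Theorems.FluctuationComparisonRegPrIntLS2BetaRelativeSizeProfileChartTower

end
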